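import Summits.Ventures.WeilGRH.KeyMinorantParity
import Summits.Ventures.WeilGRH.KeySectionToTestZeta
import Summits.Ventures.WeilGRH.BaseRungEvenTransfer
import Summits.Ventures.WeilGRH.FrontierPhaseCells
import HarnessLib

/-!
# GRH arm (rh-explicit, venture WeilGRH): THE `ζ`-TRANSFER FLOOR LAW `log q ≥ 2(sinh t + t)` —
  one `ζ` window gives the same window for EVERY Dirichlet character of large modulus

Cell `rh-explicit`, WEIL TRACK — GRH ARM (engine/certificate seat weil-grh-2, gen6; the «20 lines» of
gen5's MINORANT.md, OPEN (i), on top of the lit/typing seat's `KeyMinorant.lean` / `KeyMinorantParity.lean`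
and `KeySectionToTestZeta.lean`).

For a test function `g` supported in `[-t, t]` the EVEN all-trivial key form at level `L` is, identically,

  `keyMarkovForm 0 L 1 t g = Re Q_ζ(g) − P(g) + L‖g‖₂²`
  (`keyMarkovForm_allTrivial_zero_eq`, `weilWindowForm_eq_pole_add_keyMarkovForm`,
   `weilWindowForm_eq_re_weilQuadratic`: the Markov part of the `ζ` form IS the key form of the character mod `1`),

with the pole form `P(g) = 2|∫ g cosh(x/2)|² − 2|∫ g sinh(x/2)|² ≤ 2(sinh t + t)‖g‖₂²` (Cauchy–Schwarz on the
support, `∫_{-t}^{t} cosh²(x/2) dx = sinh t + t`; `weilPolar_re_le`).  Hence Weil positivity of `ζ` on `[-t, t]`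
makes the even pseudo-key of level `2(sinh t + t)` non-negative on test functions (`…_nonneg_of_weilPositivityOn`),
and the MINORANT LEMMA (the all-trivial even key minorises `Re Q_χ` for every character of either parity:
`weilPositivityOnChar_of_allTrivial_even_key_nonneg`, weil-grh-5 after weil-grh-2 gen5) turns this into

**THEOREM (`weilPositivityOnChar_of_weilPositivityOn`).**  `0 < t`, `WeilPositivityOn t` (for `ζ`), `q ≠ 1`,
`2(sinh t + t) ≤ log q` ⇒ `WeilPositivityOnChar χ t` for EVERY Dirichlet character `χ` mod `q` (any parity, any
values, imprimitive allowed).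

One law replaces the arm's four uniform-rung certificate families, with the SAME integer floors they reached
(`ReflectionRungs`: `(log 3)/2 ⇒ q ≥ 10`; `DoubleReflectionRungs`: `59/100 ⇒ 12`, `log 2 ⇒ 18`;
`FrontierUniformThirty` (100 phase cells): `4023/5000 ⇒ 30`), and is continuous in `t`: with the tree's largest
kernel-checked `ζ` window `EvenWinsBeyondArch.weilPositivityOn_of_le_8046` it is UNCONDITIONAL for every
`t ≤ 4023/5000` (`weilPositivityOnChar_of_le_frontier`; integer floors `⌈e^{2(sinh t + t)}⌉`: `(log 2)/2 ⇒ 5`,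
`2/5 ⇒ 6`, `(log 3)/2 ⇒ 10`, `59/100 ⇒ 12`, `log 2 ⇒ 18`, `4023/5000 ⇒ 30` — each equal to the landed uniform
theorem of that rung, checked by the `two_mul_sinh_add_*_le_log` lemmas — and the NEW rungs `18/25 ⇒ 21`,
`3/4 ⇒ 24`), and at `t = 1` it is the IMPLICATION
`WeilPositivityOn 1 → (∀ q ≥ 78, ∀ χ mod q, WeilPositivityOnChar χ 1)` (`weilPositivityOnChar_one_of_weilPositivityOn_one`):
the `ζ` rung W-M4 of the lead track would give the GRH arm's `t = 1` rung for every character of every modulus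
`≥ 78`.  Calibration against the cell's DATA (EXTREMALS/GRH/trivial-key-minorant-CERT, exact pseudo-key floors):
`75` at `t = 1`, `29` at `4023/5000`, `18` at `log 2`, `11` at `59/100`, `9` at `(log 3)/2` — the transfer through
`ζ` loses at most three conductors at every tabulated rung.

Honest scope: nothing here is a step towards RH or GRH; the unconditional statements stop at the `ζ` frontier
`4023/5000`, and below the floors nothing is claimed.  Everything is PROVED; no definitions, no named facts;
standard axioms.

## References

* A. Weil, *Sur les "formules explicites" de la théorie des nombres premiers*, Comm. Sém. Math. Univ. Lund, tome
  suppl. (1952), (11) pp. 261–262 and the «lemme» p. 262. [Weil1952FormulesExplicites]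
* H. Yoshida, *On Hermitian forms attached to zeta functions*, Adv. Stud. Pure Math. 21 (1992), §6 (6.2) (the polar
  term). [Yoshida1992]
* E. Bombieri, *Remarks on Weil's quadratic functional in the theory of prime numbers, I*, Rend. Mat. Acc. Lincei
  (9) 11 (2000), Thm 2 p. 193 (the Markov decomposition). [Bombieri2000Weil]
-/

set_option autoImplicit false

noncomputable section

open Complex Set MeasureTheory Finset
open scoped Real

namespace Summit.Ventures.WeilGRH

open Literature.NumberTheory.LFunctions

variable {q : ℕ}

/-! ## The even pseudo-key is the `ζ` window form without its pole -/

/-- **The all-trivial EVEN key form is the `ζ` window form minus the pole form, shifted by the level**: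
`keyMarkovForm 0 L 1 t w = weilWindowForm t w − P(w) + L‖w‖₂²` for every `w : ℝ → ℂ`
(the character mod `1` has parity `0`, level `log 1 = 0` and all values `1`).
[cite: Bombieri2000Weil, Thm 2 (p. 193)] -/
theorem keyMarkovForm_allTrivial_zero_eq (L t : ℝ) (w : ℝ → ℂ) :
    keyMarkovForm 0 L (fun _ ↦ 1) t w = weilWindowForm t w - weilPoleForm w + L * ∫ x : ℝ, ‖w x‖ ^ 2 := by
  have h := weilWindowForm_eq_pole_add_keyMarkovForm t w
  have hv : (fun n : ℕ ↦ (1 : DirichletCharacter ℂ 1) (n : ZMod 1)) = fun _ ↦ (1 : ℂ) :=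
    funext fun n ↦ by rw [Subsingleton.elim (n : ZMod 1) 1, map_one]
  rw [charParity_modOne, Nat.cast_one, Real.log_one, hv] at h
  rw [keyMarkovForm_eq_add_norm 0 0 L, sub_zero]
  linarith

/-- **The pole form on a window**: `P(g) ≤ 2(sinh t + t)‖g‖₂²` for a test function `g` supported in `[-t, t]`
(`P(g) = 2 Re(ĝ(0) conj ĝ(1)) = 2|∫g cosh(x/2)|² − 2|∫g sinh(x/2)|² ≤ 2|∫g cosh(x/2)|²` and Cauchy–Schwarz with
`∫_{-t}^{t} cosh²(x/2) = sinh t + t`). [cite: Yoshida1992, §6 eq. (6.2)] -/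
theorem weilPoleForm_le_of_tsupport_subset {g : ℝ → ℂ} (hg : IsWeilTest g) {t : ℝ}
    (hsupp : tsupport g ⊆ Icc (-t) t) :
    weilPoleForm g ≤ 2 * (Real.sinh t + t) * ∫ x : ℝ, ‖g x‖ ^ 2 := by
  rw [← two_mul_re_weilMellin_zero_mul_conj_one hg]
  exact weilPolar_re_le hg hsupp

/-- **`ζ` positivity on `[-t, t]` makes the even pseudo-key of level `L ≥ 2(sinh t + t)` non-negative on test
functions supported in `[-t, t]`.** [cite: Yoshida1992, §6 eq. (6.2); Bombieri2000Weil, Thm 2 (p. 193)] -/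
theorem keyMarkovForm_allTrivial_zero_nonneg_of_weilPositivityOn {t : ℝ} (hζ : WeilPositivityOn t) {L : ℝ}
    (hL : 2 * (Real.sinh t + t) ≤ L) {g : ℝ → ℂ} (hg : IsWeilTest g) (hsupp : tsupport g ⊆ Icc (-t) t) :
    0 ≤ keyMarkovForm 0 L (fun _ ↦ 1) t g := by
  rw [keyMarkovForm_allTrivial_zero_eq, weilWindowForm_eq_re_weilQuadratic hg hsupp]
  have h1 : 0 ≤ (weilQuadratic g).re := hζ g hg hsupp
  have h2 := weilPoleForm_le_of_tsupport_subset hg hsupp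
  have h3 : 0 ≤ ∫ x : ℝ, ‖g x‖ ^ 2 := integral_nonneg fun _ ↦ by positivity
  have h4 := mul_le_mul_of_nonneg_right hL h3
  linarith

/-! ## The floor law -/

/-- ★★ **THE `ζ`-TRANSFER FLOOR LAW.**  If Weil positivity holds for `ζ` on `[-t, t]` (`t > 0`), then
`WeilPositivityOnChar χ t` for EVERY Dirichlet character `χ` mod `q ≠ 1` with `2(sinh t + t) ≤ log q` — any
parity, any values, imprimitive allowed (the even all-trivial key minorises every character:
`weilPositivityOnChar_of_allTrivial_even_key_nonneg`; its level-`2(sinh t + t)` form is `≥ Re Q_ζ − P + 2(sinh t+t)‖·‖² ≥ 0`).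
[cite: Weil1952FormulesExplicites, (11) pp. 261–262 and the «lemme» p. 262; Yoshida1992, §6 eq. (6.2)] -/
theorem weilPositivityOnChar_of_weilPositivityOn {t : ℝ} (ht : 0 < t) (hζ : WeilPositivityOn t)
    (hq : q ≠ 1) (χ : DirichletCharacter ℂ q) (hL : 2 * (Real.sinh t + t) ≤ Real.log q) :
    WeilPositivityOnChar χ t := by
  have hN : Real.exp (2 * t) ≤ ((⌊Real.exp (2 * t)⌋₊ : ℕ) : ℝ) + 1 := (Nat.lt_floor_add_one _).le
  exact weilPositivityOnChar_of_allTrivial_even_key_nonneg ht hN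
    (fun g hg hsupp ↦ by
      rw [← keyMarkovForm_eq_weilFinitePrimeQuadraticKey hg hsupp hN (a := 0) (Nat.zero_le _)]
      exact keyMarkovForm_allTrivial_zero_nonneg_of_weilPositivityOn hζ le_rfl hg hsupp)
    hq χ hL

/-- `2(sinh t + t) > 0` for `t > 0`. [folklore] -/
theorem two_mul_sinh_add_pos {t : ℝ} (ht : 0 < t) : 0 < 2 * (Real.sinh t + t) := by
  have := Real.sinh_pos_iff.2 ht
  positivity

/-- The floor law with an INTEGER floor: `WeilPositivityOn t`, `2(sinh t + t) ≤ log Q`, `Q ≤ q` ⇒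
`WeilPositivityOnChar χ t` for every `χ` mod `q` (`Q ≥ 2` is forced, so `q ≠ 1`). [folklore] -/
theorem weilPositivityOnChar_of_weilPositivityOn_of_le {t : ℝ} (ht : 0 < t) (hζ : WeilPositivityOn t) {Q : ℕ}
    (hQ : 2 * (Real.sinh t + t) ≤ Real.log Q) (hQq : Q ≤ q) (χ : DirichletCharacter ℂ q) :
    WeilPositivityOnChar χ t := by
  have hpos := two_mul_sinh_add_pos ht
  have hQ1 : 1 < Q := by
    by_contra h
    have hQ' : (Q : ℝ) ≤ 1 := by exact_mod_cast not_lt.1 h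
    have : Real.log Q ≤ 0 := Real.log_nonpos (Nat.cast_nonneg _) hQ'
    linarith
  have hq : q ≠ 1 := by omega
  refine weilPositivityOnChar_of_weilPositivityOn ht hζ hq χ (hQ.trans ?_)
  exact Real.log_le_log (by exact_mod_cast (show 0 < Q by omega)) (by exact_mod_cast hQq)

/-- `sinh` from an upper bound of `exp`: `exp x ≤ U` ⇒ `sinh x ≤ (U − U⁻¹)/2`. [folklore] -/
theorem sinh_le_of_exp_le {x U : ℝ} (hU : Real.exp x ≤ U) : Real.sinh x ≤ (U - U⁻¹) / 2 := by
  have hE : 0 < Real.exp x := Real.exp_pos _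
  have hU0 : 0 < U := hE.trans_le hU
  have hi : U⁻¹ ≤ (Real.exp x)⁻¹ := by
    rw [inv_le_inv₀ hU0 hE]; exact hU
  rw [Real.sinh_eq, Real.exp_neg]
  linarith

/-! ## Unconditional: every window up to the `ζ` frontier `4023/5000` -/

/-- ★★ **Unconditional floor law up to the `ζ` frontier.**  For `0 < t ≤ 4023/5000` and every Dirichlet
character `χ` mod `q ≠ 1` with `2(sinh t + t) ≤ log q`: `WeilPositivityOnChar χ t` (the `ζ` input is the
kernel-checked `EvenWinsBeyondArch.weilPositivityOn_of_le_8046`). [cite: Weil1952FormulesExplicites, (11) pp. 261–262 and the «lemme» p. 262] -/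
theorem weilPositivityOnChar_of_le_frontier {t : ℝ} (ht : 0 < t) (htf : t ≤ 4023 / 5000) (hq : q ≠ 1)
    (χ : DirichletCharacter ℂ q) (hL : 2 * (Real.sinh t + t) ≤ Real.log q) : WeilPositivityOnChar χ t :=
  weilPositivityOnChar_of_weilPositivityOn ht
    (Summit.RiemannHypothesis.RiemannHypothesis.Theorems.EvenWinsBeyondArch.weilPositivityOn_of_le_8046 htf)
    hq χ hL

/-- The same with an integer floor `Q ≤ q`, `2(sinh t + t) ≤ log Q`. [folklore] -/
theorem weilPositivityOnChar_of_le_frontier_of_le {t : ℝ} (ht : 0 < t) (htf : t ≤ 4023 / 5000) {Q : ℕ}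
    (hQ : 2 * (Real.sinh t + t) ≤ Real.log Q) (hQq : Q ≤ q) (χ : DirichletCharacter ℂ q) :
    WeilPositivityOnChar χ t :=
  weilPositivityOnChar_of_weilPositivityOn_of_le ht
    (Summit.RiemannHypothesis.RiemannHypothesis.Theorems.EvenWinsBeyondArch.weilPositivityOn_of_le_8046 htf)
    hQ hQq χ

/-! ## The named floors `⌈e^{2(sinh t + t)}⌉` at the rungs of record -/

/-- `2(sinh(4023/5000) + 4023/5000) ≤ log 30` (`e^{4023/5000} ≤ 2.235802`, `log 30 ≥ 3.401196`). [folklore] -/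
theorem two_mul_sinh_add_frontier_le_log : 2 * (Real.sinh (4023 / 5000) + 4023 / 5000) ≤ Real.log (30 : ℕ) := by
  obtain ⟨-, he2⟩ := exp_frontier_bounds
  have hs := sinh_le_of_exp_le he2
  have hl := log_thirty_ge
  push_cast
  nlinarith

/-- `sinh(log 2) = 3/4`. [folklore] -/
theorem sinh_log_two : Real.sinh (Real.log 2) = 3 / 4 := by
  rw [Real.sinh_eq, Real.exp_neg, Real.exp_log (by norm_num)]
  norm_num

/-- `2(sinh(log 2) + log 2) ≤ log 18` (`3/2 + 2 log 2 ≤ log 2 + 2 log 3`). [folklore] -/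
theorem two_mul_sinh_add_log_two_le_log : 2 * (Real.sinh (Real.log 2) + Real.log 2) ≤ Real.log (18 : ℕ) := by
  rw [sinh_log_two]
  push_cast
  rw [show (18 : ℝ) = 2 * 3 ^ 2 by norm_num, Real.log_mul (by norm_num) (by norm_num), Real.log_pow]
  push_cast
  linarith [Real.log_two_lt_d9, Real.log_three_gt_d9]

/-- `e^{(log 3)/2} ≤ 1.73206` (its square is `3`). [folklore] -/
theorem exp_log_three_half_le : Real.exp (Real.log 3 / 2) ≤ 1.73206 := by
  have hsq : Real.exp (Real.log 3 / 2) * Real.exp (Real.log 3 / 2) = 3 := by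
    rw [← Real.exp_add, add_halves, Real.exp_log (by norm_num)]
  have hE : 0 < Real.exp (Real.log 3 / 2) := Real.exp_pos _
  nlinarith

/-- `2(sinh((log 3)/2) + (log 3)/2) ≤ log 10`. [folklore] -/
theorem two_mul_sinh_add_log_three_half_le_log :
    2 * (Real.sinh (Real.log 3 / 2) + Real.log 3 / 2) ≤ Real.log (10 : ℕ) := by
  have hs := sinh_le_of_exp_le exp_log_three_half_le
  push_cast
  rw [show (10 : ℝ) = 2 * 5 by norm_num, Real.log_mul (by norm_num) (by norm_num)]
  nlinarith [Real.log_two_gt_d9, Real.log_three_lt_d9, Real.log_five_gt_d9]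

/-- `e^{(log 2)/2} ≤ 1.41422` (its square is `2`). [folklore] -/
theorem exp_log_two_half_le : Real.exp (Real.log 2 / 2) ≤ 1.41422 := by
  have hsq : Real.exp (Real.log 2 / 2) * Real.exp (Real.log 2 / 2) = 2 := by
    rw [← Real.exp_add, add_halves, Real.exp_log (by norm_num)]
  have hE : 0 < Real.exp (Real.log 2 / 2) := Real.exp_pos _
  nlinarith

/-- `2(sinh((log 2)/2) + (log 2)/2) ≤ log 5`. [folklore] -/
theorem two_mul_sinh_add_log_two_half_le_log :
    2 * (Real.sinh (Real.log 2 / 2) + Real.log 2 / 2) ≤ Real.log (5 : ℕ) := by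
  have hs := sinh_le_of_exp_le exp_log_two_half_le
  push_cast
  nlinarith [Real.log_two_lt_d9, Real.log_five_gt_d9]

/-- Ten terms of the exponential series bound `e^x` from above on `[0, 1]`. [folklore] -/
theorem exp_le_taylor_ten {x : ℝ} (h0 : 0 ≤ x) (h1 : x ≤ 1) :
    Real.exp x ≤ (∑ m ∈ range 10, x ^ m / m.factorial) + x ^ 10 * (10 + 1) / (Nat.factorial 10 * 10) := by
  have h := Real.exp_bound' h0 h1 (n := 10) (by norm_num)
  exact_mod_cast h

/-- `e^{3/4} ≤ 2.1171`. [folklore] -/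
theorem exp_three_quarters_le : Real.exp (3 / 4) ≤ 2.1171 := by
  have h := exp_le_taylor_ten (x := 3 / 4) (by norm_num) (by norm_num)
  simp only [sum_range_succ, sum_range_zero, Nat.factorial] at h
  norm_num at h
  linarith

/-- `2(sinh(3/4) + 3/4) ≤ log 24`. [folklore] -/
theorem two_mul_sinh_add_three_quarters_le_log : 2 * (Real.sinh (3 / 4) + 3 / 4) ≤ Real.log (24 : ℕ) := by
  have hs := sinh_le_of_exp_le exp_three_quarters_le
  push_cast
  rw [show (24 : ℝ) = 2 ^ 3 * 3 by norm_num, Real.log_mul (by norm_num) (by norm_num), Real.log_pow]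
  push_cast
  nlinarith [Real.log_two_gt_d9, Real.log_three_gt_d9]

/-- `e^{18/25} ≤ 2.0545`. [folklore] -/
theorem exp_eighteen_twentyfifths_le : Real.exp (18 / 25) ≤ 2.0545 := by
  have h := exp_le_taylor_ten (x := 18 / 25) (by norm_num) (by norm_num)
  simp only [sum_range_succ, sum_range_zero, Nat.factorial] at h
  norm_num at h
  linarith

/-- `log 7 ≥ 3 log 2 − 1/7` (`log(8/7) ≤ 1/7`). [folklore] -/
theorem log_seven_ge : 3 * Real.log 2 - 1 / 7 ≤ Real.log 7 := by
  have h : Real.log (8 / 7) ≤ 8 / 7 - 1 := Real.log_le_sub_one_of_pos (by norm_num)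
  have h8 : Real.log (8 / 7) = Real.log 8 - Real.log 7 := Real.log_div (by norm_num) (by norm_num)
  rw [show (8 : ℝ) = 2 ^ 3 by norm_num, Real.log_pow] at h8
  push_cast at h8
  linarith

/-- `2(sinh(18/25) + 18/25) ≤ log 21`. [folklore] -/
theorem two_mul_sinh_add_eighteen_twentyfifths_le_log :
    2 * (Real.sinh (18 / 25) + 18 / 25) ≤ Real.log (21 : ℕ) := by
  have hs := sinh_le_of_exp_le exp_eighteen_twentyfifths_le
  push_cast
  rw [show (21 : ℝ) = 3 * 7 by norm_num, Real.log_mul (by norm_num) (by norm_num)]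
  nlinarith [Real.log_two_gt_d9, Real.log_three_gt_d9, log_seven_ge]

/-- `e^{59/100} ≤ 1.8041`. [folklore] -/
theorem exp_fiftynine_hundredths_le : Real.exp (59 / 100) ≤ 1.8041 := by
  have h := exp_le_taylor_ten (x := 59 / 100) (by norm_num) (by norm_num)
  simp only [sum_range_succ, sum_range_zero, Nat.factorial] at h
  norm_num at h
  linarith

/-- `2(sinh(59/100) + 59/100) ≤ log 12`. [folklore] -/
theorem two_mul_sinh_add_fiftynine_le_log : 2 * (Real.sinh (59 / 100) + 59 / 100) ≤ Real.log (12 : ℕ) := by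
  have hs := sinh_le_of_exp_le exp_fiftynine_hundredths_le
  push_cast
  rw [show (12 : ℝ) = 2 ^ 2 * 3 by norm_num, Real.log_mul (by norm_num) (by norm_num), Real.log_pow]
  push_cast
  nlinarith [Real.log_two_gt_d9, Real.log_three_gt_d9]

/-- `e^{2/5} ≤ 1.4919`. [folklore] -/
theorem exp_two_fifths_le : Real.exp (2 / 5) ≤ 1.4919 := by
  have h := exp_le_taylor_ten (x := 2 / 5) (by norm_num) (by norm_num)
  simp only [sum_range_succ, sum_range_zero, Nat.factorial] at h
  norm_num at h
  linarith

/-- `2(sinh(2/5) + 2/5) ≤ log 6`. [folklore] -/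
theorem two_mul_sinh_add_two_fifths_le_log : 2 * (Real.sinh (2 / 5) + 2 / 5) ≤ Real.log (6 : ℕ) := by
  have hs := sinh_le_of_exp_le exp_two_fifths_le
  push_cast
  rw [show (6 : ℝ) = 2 * 3 by norm_num, Real.log_mul (by norm_num) (by norm_num)]
  nlinarith [Real.log_two_gt_d9, Real.log_three_gt_d9]

/-- `2(sinh 1 + 1) ≤ log 78` (`e ≤ 2.7182818286`; `log 78 = 4 log 3 − log(81/78) ≥ 4 log 3 − 1/26`). [folklore] -/
theorem two_mul_sinh_add_one_le_log : 2 * (Real.sinh 1 + 1) ≤ Real.log (78 : ℕ) := by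
  have hs := sinh_le_of_exp_le Real.exp_one_lt_d9.le
  have h : Real.log (81 / 78) ≤ 81 / 78 - 1 := Real.log_le_sub_one_of_pos (by norm_num)
  have h8 : Real.log (81 / 78) = Real.log 81 - Real.log 78 := Real.log_div (by norm_num) (by norm_num)
  rw [show (81 : ℝ) = 3 ^ 4 by norm_num, Real.log_pow] at h8
  push_cast at h8 ⊢
  nlinarith [Real.log_three_gt_d9]

/-! ### Calibration against the landed uniform rungs

With the numeric lemmas above, `weilPositivityOnChar_of_le_frontier_of_le` reproduces — with the SAME integer
floors — the arm's four landed uniform-rung theorems, which therefore need not be restated here: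
`weilPositivityOnChar_frontier_of_ge_thirty` (`FrontierUniformThirty.lean`, `4023/5000 ⇒ 30`,
`two_mul_sinh_add_frontier_le_log`), `weilPositivityOnChar_log_two_of_ge_eighteen` and
`weilPositivityOnChar_fiftynine_of_ge_twelve` (`DoubleReflectionRungs.lean`, `two_mul_sinh_add_log_two_le_log`,
`two_mul_sinh_add_fiftynine_le_log`), `weilPositivityOnChar_log_three_half_of_ge_ten` and
`weilPositivityOnChar_two_fifths_of_ge_six` (`ReflectionRungs.lean`, `two_mul_sinh_add_log_three_half_le_log`,
`two_mul_sinh_add_two_fifths_le_log`), `weilPositivityOnChar_log_two_half` (`BaseRungOddTransfer.lean`, `q ≥ 5`,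
`two_mul_sinh_add_log_two_half_le_log`).  The two rungs below had no uniform theorem. -/

/-- ★ `t = 3/4`: every `χ` mod `q ≥ 24` (data floor of the even pseudo-key: `23`). [folklore] -/
theorem weilPositivityOnChar_three_quarters_of_ge (hq : 24 ≤ q) (χ : DirichletCharacter ℂ q) :
    WeilPositivityOnChar χ (3 / 4) :=
  weilPositivityOnChar_of_le_frontier_of_le (by norm_num) (by norm_num)
    two_mul_sinh_add_three_quarters_le_log hq χ

/-- ★ `t = 18/25`: every `χ` mod `q ≥ 21` (data floor: `20`). [folklore] -/
theorem weilPositivityOnChar_eighteen_twentyfifths_of_ge (hq : 21 ≤ q) (χ : DirichletCharacter ℂ q) :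
    WeilPositivityOnChar χ (18 / 25) :=
  weilPositivityOnChar_of_le_frontier_of_le (by norm_num) (by norm_num)
    two_mul_sinh_add_eighteen_twentyfifths_le_log hq χ

/-! ## Conditional: the `ζ` rung `t = 1` (W-M4) would give every character of modulus `≥ 78` -/

/-- ★★ **`WeilPositivityOn 1 → t = 1 for every Dirichlet character of every modulus `q ≥ 78`** (indeed every
window `0 < t ≤ 1`; `2(sinh 1 + 1) = 4.3504… ≤ log 78`; the cell's exact pseudo-key floor at `t = 1` is `75`).
An implication, not a claim that either side holds. [cite: Weil1952FormulesExplicites, the «lemme» p. 262] -/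
theorem weilPositivityOnChar_one_of_weilPositivityOn_one (hζ : WeilPositivityOn 1) {t : ℝ} (ht : 0 < t)
    (ht1 : t ≤ 1) (hq : 78 ≤ q) (χ : DirichletCharacter ℂ q) : WeilPositivityOnChar χ t := by
  refine weilPositivityOnChar_of_weilPositivityOn_of_le ht (hζ.mono ht1) ?_ hq χ
  have hs : Real.sinh t ≤ Real.sinh 1 := Real.sinh_le_sinh.2 ht1
  have h1 := two_mul_sinh_add_one_le_log
  linarith

end Summit.Ventures.WeilGRH

end
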